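import Summits.CriticalPhenomena.SAWScalingLimit.Theses.SAWZoomRigidity
import Literature.Probability.RandomPlanarGeometry.SAWSubseqScalingLimit
import Literature.Probability.RandomPlanarGeometry.ChordalReversibility
import Literature.Probability.RandomPlanarGeometry.ChordalRestrictionMarkov
import Literature.Probability.RandomPlanarGeometry.LatticeSimilarityCovariance

/-!
# Line `birth` — registered skeleton for the crux `SubseqLimitAxioms` (stmt-CriticalPhenomena-6501)

Crux (FIXED; rank 4 of `route-CriticalPhenomena-SAWZoomRigidity`): every chordal family `P` in the set
`Ω_SAW` of JOINT SUBSEQUENTIAL scaling limits of the critical `δℤ²` SAW — `P.IsChordal` and, along SOME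
mesh sequence `δₙ → 0⁺`, for every Dobrushin domain and EVERY endpoint approximation the SAW laws pushed to
curve classes converge weakly to `P D` — is NICE:

  `P.IsChordal ∧ (restriction-coupled Markov kernel) ∧ (reversal) ∧ (z ↦ iᵏ·z + w covariance)
   ∧ (conjugation covariance) ∧ (a.s. simple, meeting ∂D only at a, b)`,

with NO dilation covariance (that is the job of the crux `ZoomRigidity`).

The hypothesis is, literally, `P ∈ SAW.subseqLimitSet` (`Literature/…/SAWSubseqScalingLimit.lean`,
`mem_subseqLimitSet_iff` and `isSubseqScalingLimitFamily_iff` are `Iff.rfl`); the Markov conjunct is,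
literally, `P.IsRestrictionMarkov` (`ChordalRestrictionMarkov.lean`, `isRestrictionMarkov_iff` is
`Iff.rfl`), the reversal conjunct is `P.IsReversible` (`ChordalReversibility.lean`). The similarity
conjunct is NOT `P.IsLatticeSimilarityCovariant` (that predicate contains the dilations `r > 0`): it is
covariance under `z ↦ iᵏ z + w` only, and it is CUT below into its two mathematically different halves —
the quarter-turns about the origin (exact at every mesh: `i·δℤ² = δℤ²`) and the translations by an
arbitrary `w ∈ ℂ` (NOT exact along a fixed mesh sequence: `w ∉ δₙℤ²` in general, so sub-mesh
domain-perturbation stability is needed — the Kennedy–Lawler boundary-lattice-effect issue named in the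
crux's why-it-might-fail line) — and RE-COMPOSED in the skeleton theorem by `ChordalFamily.covariant_trans`.

## The cut (the route header's "NOT DECOMPOSED YET: the three passages of SubseqLimitAxioms", refined
## to five named passages and threaded so that each passage may use the earlier ones)

* S1 `stub_exactSymmetryPassage` — EXACT LATTICE SYMMETRIES FIXING THE MESH SEQUENCE PASS TO EVERY JOINT
  SUBSEQUENTIAL LIMIT: `P ∈ Ω_SAW → P.IsReversible ∧ (∀ D k, P (iᵏ D) = (iᵏ·)_* P D) ∧ (∀ D, P (D̄) = conj_* P D)`.
  Reversal `ω ↦ ω^R`, the quarter-turns `z ↦ iᵏ z` and `z ↦ z̄` map `δℤ²` onto itself for EVERY `δ`, and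
  transport `meshDomain / discreteDomainGraph / DomainSAW / weight x_c^{|γ|} / law / curve` exactly
  (edges inside `Ω̄` go to edges inside the closure of the image domain); endpoint approximations transport
  (`IsEndpointApprox.swap` for reversal; `a ↦ iᵏ a`, `a ↦ ā` on `Site 2`); both sides of each identity are
  then limits of the SAME sequence of measures, and weak limits of finite measures along a sequence are
  unique (`SAW.IsSubseqScalingLimitFamily.apply_eq`, `SAW.exists_isEndpointApprox`,
  `ext_of_forall_integral_eq_of_IsFiniteMeasure`; reversal transport in the tree:
  `SupercriticalSAW.lawAt_map_sawReverse`, `curve_sawReverse`, `isSubseqLimitLaw_map_reverse`; the `z ↦ -z`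
  transport `sawNeg…` exists on the disc only). Size M–L (lattice transport API for `iᵏ` and `conj` on a
  general domain is not in the tree). Plausibly TRUE unconditionally.
* S2 `stub_simplePassage` — EVERY JOINT SUBSEQUENTIAL LIMIT IS CARRIED BY SIMPLE CURVES MEETING ∂D ONLY AT
  a, b. `CurveClass.simple` is not closed, so nothing soft gives it: a uniform-in-mesh no-near-self-touching
  / no-boundary-crawling estimate for the `x_c`-SAW under EVERY endpoint approximation (LSW04 §3.4.5
  heuristic; Kennedy–Lawler arXiv:1109.3091; in print only sub-ballisticity, Duminil-Copin–Hammond 2013,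
  and Kesten-pattern arguments). Same mathematical content as `SAWConfRestriction.SimpleOfLimit` /
  `AxiomsOfLimit.Birth.stub_simplePassage` but for SUBSEQUENTIAL limits (weaker hypothesis, so a stronger
  statement: no full-filter trick is available). Size L–XL. HARDEST (open estimate at `x_c`).
* S3 `stub_restrictionPassage` — TWO-SIDED RESTRICTION PASSES TO THE LIMIT, GIVEN S2's conclusion:
  `P ∈ Ω_SAW → (simple ∧ boundary-avoiding a.s.) → P.IsRestriction`. Lattice level:
  `P_δ^{D'}(T) · P_δ^{D}(γ ⊆ D̄') = P_δ^{D}(T ∩ {γ ⊆ D̄'})` is an identity of the weights `x_c^{|γ|}`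
  (LSW04 §3.4.5) up to the largest-component bookkeeping `D'_δ` versus `D_δ ∩ D̄'`; the passage runs
  portmanteau along `δₙ` on the closed event `{range ⊆ closure D'}` relative to the chordal curves of `D̄`,
  whose relative boundary ("touches `∂D' ∩ D` without crossing", "crawls on `∂D ∩ ∂D'`") must be `P D`-null
  — the second part is the hypothesis from S2, the first comes from monotonicity in `D'`. Size L.
* S4 `stub_markovPassage` — THE RESTRICTION-COUPLED MARKOV KERNEL OF THE LIMIT, GIVEN S2, S3:
  `P ∈ Ω_SAW → P.IsRestriction → (simple ∧ boundary-avoiding a.s.) → P.IsRestrictionMarkov`. CONSTRUCT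
  `Q D past` with the three `IsMarkovExtension` clauses and the `IsRestrictionKernel` coupling. Lattice
  level the conditional future given a lattice past IS the critical SAW of the slit graph (LSW04 §2.3),
  exactly; the passage needs SAW limits in slit domains perturbed near the tip — beyond `Ω_SAW`, which only
  speaks of Jordan domains — or an intrinsic construction of `Q` from `P` through restriction to Jordan
  sub-domains of the slit domain (S3 is its trivial-past case: `IsRestrictionKernel.isRestriction`).
  Size XL.
* S5 `stub_translationPassage` — TRANSLATION COVARIANCE OF EVERY JOINT SUBSEQUENTIAL LIMIT, GIVEN S2:
  `P ∈ Ω_SAW → (simple ∧ boundary-avoiding a.s.) → ∀ D w, P (D + w) = (· + w)_* P D`. Along the fixed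
  sequence `δₙ` only lattice vectors `wₙ ∈ δₙℤ²`, `wₙ → w`, translate exactly
  (`(τ_{wₙ})_* P_{δₙ}^{D} = P_{δₙ}^{D + wₙ}`), and `(τ_{wₙ})_* P_{δₙ}^{D} ⇀ (τ_w)_* P D`; the content is
  SUB-MESH DOMAIN STABILITY: the SAW laws of the discretisations of `D + w` and of `D + wₙ`
  (`|w - wₙ| ≤ δₙ`) have the same weak limit along `δₙ` — a uniform-in-`n` modulus of continuity of the
  law under boundary perturbations of size `≤ δₙ` (exact lattice restriction squeeze into a common pinched
  sub-domain + no boundary crawling, which the hypothesis from S2 supplies in the limit via portmanteau,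
  + endpoint robustness under `IsEndpointApprox`). This is exactly the "Kennedy–Lawler boundary lattice
  effects" clause of the crux's why-it-might-fail line, isolated. Size L.

`SubseqLimitAxioms_of` (kernel-checked, no `sorry` of its own) threads S2 → S3 → S4 and S2 → S5, unbundles
S1, and REBUILDS the crux's similarity clause `∀ D c hc w, (∃ k, c = iᵏ) → P (c·D + w) = (c· + w)_* P D`
from S1's origin quarter-turns and S5's translations by factoring `z ↦ iᵏ z + w = (z ↦ z + w) ∘ (z ↦ iᵏ z)`
(`similarity (I^k) hc w = (similarity (I^k) hc 0).trans (similarity 1 _ w)`) and composing covariances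
(`ChordalFamily.covariant_trans`, `measurable_curveClassMap_similarity`). Hypotheses = the five stubs under
their registered names (`__Registered.stub_…`, see below); conclusion = the route decl
`Summit.CriticalPhenomena.SAWScalingLimit.Theses.SAWZoomRigidity.SubseqLimitAxioms` BY NAME.

Every stub is a CONSEQUENCE of the crux (each conclusion is a conjunct or a specialisation of one — S1's
quarter-turn clause is the similarity clause at `w = 0`, S5 is it at `k = 0` — and extra hypotheses only
weaken), so the cut loses nothing: the five stubs hold iff the crux holds. No `Disproof.lean` exists for
this crux (`ledger crux ls stmt-CriticalPhenomena-6501`: no workfiles, 2026-08-17), so no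
`_false_without_` obstruction is on record; negatives index: the refuted all-δ tightness
stmt-CriticalPhenomena-0772 is not touched (only a fixed sequence `δₙ → 0⁺` occurs, inside `Ω_SAW`).
Sibling skeleton: `Cruxes/AxiomsOfLimit/Lines/birth.lean` (full-limit version of the same passages for
route SAWRestrictionRigidity); the differences forced by SUBSEQUENTIAL limits are (i) no dilation clause,
(ii) translations are no longer exact along a subsequence of the filter, hence the separate stub S5.
-/

noncomputable section

open MeasureTheory Filter Topology Set
open Literature.Probability.RandomPlanarGeometry Literature.Probability.LatticeModels

namespace Summit.CriticalPhenomena.SAWScalingLimit.Cruxes.SubseqLimitAxioms.Birth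

/-! ### Vocabulary of the line: the five passages as named statements -/

/-- The simplicity / boundary-avoidance clause of the crux for one family `P`: every `P D` is carried by
simple curves meeting `∂D` only at the two marked points. -/
def SimpleBoundaryAvoiding (P : ChordalFamily) : Prop :=
  ∀ D : DobrushinDomain, ∀ᵐ γ ∂(P D),
    γ ∈ CurveClass.simple ∧ γ.range ∩ frontier D.carrier ⊆ {D.pt 0, D.pt 1}

/-- Covariance under the quarter-turns about the origin `z ↦ iᵏ z` (the similarity clause of the crux at
`w = 0`): the rotations of the square lattice, exact at every mesh. -/
def OriginQuarterTurnCovariant (P : ChordalFamily) : Prop :=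
  ∀ (D : DobrushinDomain) (k : ℕ) (hc : Complex.I ^ k ≠ 0),
    P (D.map (similarity (Complex.I ^ k) hc 0)) =
      (P D).map (CurveClass.map (similarity (Complex.I ^ k) hc 0 : C(ℂ, ℂ)))

/-- Covariance under complex conjugation `z ↦ z̄` (the conjugation clause of the crux, verbatim). -/
def ConjugationCovariant (P : ChordalFamily) : Prop :=
  ∀ D : DobrushinDomain,
    P (D.map Complex.conjLIE.toHomeomorph) =
      (P D).map (CurveClass.map (Complex.conjLIE.toHomeomorph : C(ℂ, ℂ)))

/-- Covariance under all translations `z ↦ z + w`, `w ∈ ℂ` (the similarity clause of the crux at `k = 0`):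
NOT exact along a fixed mesh sequence — the sub-mesh stability content of the crux. -/
def TranslationCovariant (P : ChordalFamily) : Prop :=
  ∀ (D : DobrushinDomain) (w : ℂ) (h1 : (1 : ℂ) ≠ 0),
    P (D.map (similarity 1 h1 w)) = (P D).map (CurveClass.map (similarity 1 h1 w : C(ℂ, ℂ)))

/-- **S1, named.** Exact lattice symmetries compatible with every mesh (reversal; quarter-turns about the
origin; conjugation) pass to every joint subsequential scaling limit. -/
def ExactSymmetryPassage : Prop :=
  ∀ P : ChordalFamily, P ∈ SAW.subseqLimitSet →
    P.IsReversible ∧ OriginQuarterTurnCovariant P ∧ ConjugationCovariant P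

/-- **S2, named.** Every joint subsequential scaling limit is carried by simple, boundary-avoiding curves. -/
def SimplePassage : Prop :=
  ∀ P : ChordalFamily, P ∈ SAW.subseqLimitSet → SimpleBoundaryAvoiding P

/-- **S3, named.** Two-sided restriction passes to every simple, boundary-avoiding joint subsequential limit. -/
def RestrictionPassage : Prop :=
  ∀ P : ChordalFamily, P ∈ SAW.subseqLimitSet → SimpleBoundaryAvoiding P → P.IsRestriction

/-- **S4, named.** Every simple, boundary-avoiding joint subsequential limit with restriction carries a
restriction-coupled domain-Markov kernel. -/
def MarkovPassage : Prop :=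
  ∀ P : ChordalFamily, P ∈ SAW.subseqLimitSet → P.IsRestriction → SimpleBoundaryAvoiding P →
    P.IsRestrictionMarkov

/-- **S5, named.** Every simple, boundary-avoiding joint subsequential limit is translation covariant. -/
def TranslationPassage : Prop :=
  ∀ P : ChordalFamily, P ∈ SAW.subseqLimitSet → SimpleBoundaryAvoiding P → TranslationCovariant P

/-! ### The stubs (the ONLY `sorry`s of this file)

Each stub is stated over TREE VOCABULARY ONLY (the named statements above unfolded by hand), so that it lands
verbatim as a `Theorems/…` file `--supports stmt-CriticalPhenomena-6501` without importing this workfile; the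
`*_holds` theorems below certify definitionally that the unfolded text IS the named statement. -/

/-- **S1 — exact lattice symmetries pass to joint subsequential limits.** A joint subsequential scaling
limit `P ∈ Ω_SAW` (along some `δₙ → 0⁺`) is reversible (`P (D; b, a) = reverse_* P (D; a, b)`), covariant
under the quarter-turns about the origin `z ↦ iᵏ z` and under `z ↦ z̄`. All three symmetries preserve
`δₙℤ²` for every `n` and transport discrete domains, SAWs, weights `x_c^{|γ|}`, laws, polylines and
endpoint approximations exactly; both sides are limits of the same sequence of finite measures, and such
limits are unique (`SAW.IsSubseqScalingLimitFamily.apply_eq`, `SAW.exists_isEndpointApprox`). -/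
theorem stub_exactSymmetryPassage :
    ∀ P : ChordalFamily, P ∈ SAW.subseqLimitSet →
      P.IsReversible ∧
        (∀ (D : DobrushinDomain) (k : ℕ) (hc : Complex.I ^ k ≠ 0),
          P (D.map (similarity (Complex.I ^ k) hc 0)) =
            (P D).map (CurveClass.map (similarity (Complex.I ^ k) hc 0 : C(ℂ, ℂ)))) ∧
        (∀ D : DobrushinDomain,
          P (D.map Complex.conjLIE.toHomeomorph) =
            (P D).map (CurveClass.map (Complex.conjLIE.toHomeomorph : C(ℂ, ℂ)))) := by
  sorry

/-- **S2 (hardest) — joint subsequential limits are carried by simple curves meeting `∂D` only at the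
marked points.** A genuine uniform-in-mesh lattice estimate (no macroscopic near-self-touching, no boundary
crawling of the critical SAW under every endpoint approximation); `CurveClass.simple` is not a closed
event, so nothing soft gives it, and no theorem in print supplies it at `x = x_c`. -/
theorem stub_simplePassage :
    ∀ P : ChordalFamily, P ∈ SAW.subseqLimitSet →
      ∀ D : DobrushinDomain, ∀ᵐ γ ∂(P D),
        γ ∈ CurveClass.simple ∧ γ.range ∩ frontier D.carrier ⊆ {D.pt 0, D.pt 1} := by
  sorry

/-- **S3 — two-sided restriction passes to the limit, given simplicity and boundary avoidance.** The
lattice restriction identity (LSW04 §3.4.5) is exact at every mesh (up to the largest-component bookkeeping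
`D'_δ` versus `D_δ ∩ D̄'`); the passage runs portmanteau along `δₙ`, relative to the chordal curves of
`D̄`, on the closed event `{range ⊆ closure D'}`, whose relative boundary is null by "no touching of
`∂D' ∩ D` without crossing" (monotonicity in `D'`) and "no crawling on `∂D`" (the hypothesis);
sub-domains pinched at `a` or `b` are `P D`-null, where the product identity is vacuous. -/
theorem stub_restrictionPassage :
    ∀ P : ChordalFamily, P ∈ SAW.subseqLimitSet →
      (∀ D : DobrushinDomain, ∀ᵐ γ ∂(P D),
        γ ∈ CurveClass.simple ∧ γ.range ∩ frontier D.carrier ⊆ {D.pt 0, D.pt 1}) →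
      P.IsRestriction := by
  sorry

/-- **S4 — the restriction-coupled domain-Markov kernel of the limit, given restriction and simplicity.**
Construct `Q D past` with `P.IsMarkovExtension Q` (initial clause, disintegration of `P D` at the hitting
time of every closed set, dependence only on the remaining slit domain, tip and target) and
`P.IsRestrictionKernel Q` (conditioned into any Dobrushin sub-domain of the slit domain pinned at the tip,
the future is `P` there). Lattice level: the conditional future given a lattice past IS the critical SAW
of the slit graph (LSW04 §2.3); the passage needs stability of SAW limits in slit domains perturbed near
the tip, or an intrinsic construction of `Q` from `P` through restriction to Jordan sub-domains. -/
theorem stub_markovPassage :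
    ∀ P : ChordalFamily, P ∈ SAW.subseqLimitSet → P.IsRestriction →
      (∀ D : DobrushinDomain, ∀ᵐ γ ∂(P D),
        γ ∈ CurveClass.simple ∧ γ.range ∩ frontier D.carrier ⊆ {D.pt 0, D.pt 1}) →
      P.IsRestrictionMarkov := by
  sorry

/-- **S5 — translation covariance of joint subsequential limits, given simplicity and boundary
avoidance (sub-mesh domain stability).** Along the fixed sequence `δₙ` only lattice vectors
`wₙ ∈ δₙℤ²`, `wₙ → w`, translate exactly, and `(τ_{wₙ})_* P_{δₙ}^{D} = P_{δₙ}^{D + wₙ} ⇀ (τ_w)_* P D`;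
what must be shown is that the SAW laws of the discretisations of `D + w` and of `D + wₙ`
(`|w - wₙ| ≤ δₙ`) have the same weak limit along `δₙ`: a uniform-in-`n` modulus of continuity of the
critical SAW law under boundary perturbations of one mesh (exact lattice restriction squeeze into a common
pinched sub-domain + no boundary crawling, supplied in the limit by the hypothesis via portmanteau +
endpoint robustness under `IsEndpointApprox`) — the Kennedy–Lawler boundary-lattice-effect clause of the
crux, isolated. -/
theorem stub_translationPassage :
    ∀ P : ChordalFamily, P ∈ SAW.subseqLimitSet →
      (∀ D : DobrushinDomain, ∀ᵐ γ ∂(P D),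
        γ ∈ CurveClass.simple ∧ γ.range ∩ frontier D.carrier ⊆ {D.pt 0, D.pt 1}) →
      ∀ (D : DobrushinDomain) (w : ℂ) (h1 : (1 : ℂ) ≠ 0),
        P (D.map (similarity 1 h1 w)) =
          (P D).map (CurveClass.map (similarity 1 h1 w : C(ℂ, ℂ))) := by
  sorry

/-! ### Consistency: each named statement IS its registered stub (definitionally) -/

theorem exactSymmetryPassage_holds : ExactSymmetryPassage := stub_exactSymmetryPassage
theorem simplePassage_holds : SimplePassage := stub_simplePassage
theorem restrictionPassage_holds : RestrictionPassage := stub_restrictionPassage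
theorem markovPassage_holds : MarkovPassage := stub_markovPassage
theorem translationPassage_holds : TranslationPassage := stub_translationPassage

/-! ### Name-keyed aliases of the five statements — the hypotheses of `SubseqLimitAxioms_of`

The native skeleton audit (`#h21_check_skeleton`) admits a hypothesis of the skeleton theorem only if its head
constant is a registered obligation or is NAMED like a declared stub; `__Registered.stub_X` is the statement of
`stub_X` under that name (device of `Cruxes/AxiomsOfLimit/Lines/birth.lean`: the `__` namespace is an
implementation detail, so the audit's stub report resolves each `stub_…` to the sorried theorem, not to the
alias; the gate-reserved `@[stub]` attribute is not written by a planner). Each alias is `rfl`-equal to its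
statement. -/
namespace __Registered

/-- Alias of `ExactSymmetryPassage` keyed by the registered stub name. -/
abbrev stub_exactSymmetryPassage : Prop := ExactSymmetryPassage
/-- Alias of `SimplePassage` keyed by the registered stub name. -/
abbrev stub_simplePassage : Prop := SimplePassage
/-- Alias of `RestrictionPassage` keyed by the registered stub name. -/
abbrev stub_restrictionPassage : Prop := RestrictionPassage
/-- Alias of `MarkovPassage` keyed by the registered stub name. -/
abbrev stub_markovPassage : Prop := MarkovPassage
/-- Alias of `TranslationPassage` keyed by the registered stub name. -/
abbrev stub_translationPassage : Prop := TranslationPassage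

end __Registered

/-! ### The skeleton theorem: the five stubs imply the crux, BY NAME -/

/-- **`SubseqLimitAxioms` from the line `birth`** (kernel-checked, no `sorry` of its own): read the crux's
hypothesis as `P ∈ SAW.subseqLimitSet` (definitional), run S2 (simplicity), feed it to S3 (restriction),
feed both to S4 (restriction-coupled Markov kernel) and S2 to S5 (translations), unbundle S1 (reversal +
origin quarter-turns + conjugation), and REBUILD the similarity clause `z ↦ iᵏ z + w` by factoring it as the
quarter-turn `z ↦ iᵏ z` followed by the translation `z ↦ z + w` and composing the two covariances
(`ChordalFamily.covariant_trans`); the other identifications are definitional (`mem_subseqLimitSet_iff`,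
`isReversible_iff`, `isRestrictionMarkov_iff` are `Iff.rfl`). Hypotheses = the five stubs, under their
registered names; conclusion = the route decl, by name. -/
theorem SubseqLimitAxioms_of (hY : __Registered.stub_exactSymmetryPassage)
    (hS : __Registered.stub_simplePassage) (hR : __Registered.stub_restrictionPassage)
    (hM : __Registered.stub_markovPassage) (hT : __Registered.stub_translationPassage) :
    Summit.CriticalPhenomena.SAWScalingLimit.Theses.SAWZoomRigidity.SubseqLimitAxioms := by
  intro P hP
  have hmem : P ∈ SAW.subseqLimitSet := hP
  have hs : SimpleBoundaryAvoiding P := hS P hmem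
  have hr : P.IsRestriction := hR P hmem hs
  obtain ⟨Q, hQ, hK⟩ := hM P hmem hr hs
  obtain ⟨hrev, hrot, hconj⟩ := hY P hmem
  have htr : TranslationCovariant P := hT P hmem hs
  refine ⟨hP.1, ⟨Q, hQ, hK⟩, hrev, ?_, hconj, hs⟩
  rintro D c hc w ⟨k, rfl⟩
  -- `z ↦ iᵏ z + w` is the quarter-turn `z ↦ iᵏ z` followed by the translation `z ↦ z + w`
  have hfac : similarity (Complex.I ^ k) hc w =
      (similarity (Complex.I ^ k) hc 0).trans (similarity 1 one_ne_zero w) := by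
    ext1 z
    simp only [Homeomorph.trans_apply, similarity_apply]
    ring
  rw [hfac]
  exact ChordalFamily.covariant_trans (measurable_curveClassMap_similarity _ hc 0)
    (measurable_curveClassMap_similarity 1 one_ne_zero w) (fun D => hrot D k hc)
    (fun D => htr D w one_ne_zero) D

/-- Wiring check (an `example`, so that `SubseqLimitAxioms_of` stays the only theorem concluding the crux):
the registered stubs, with their tree-vocabulary types, feed the skeleton theorem as stated — this term
becomes the crux proof when the five `sorry`s above are discharged. -/
example : Summit.CriticalPhenomena.SAWScalingLimit.Theses.SAWZoomRigidity.SubseqLimitAxioms :=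
  SubseqLimitAxioms_of stub_exactSymmetryPassage stub_simplePassage stub_restrictionPassage
    stub_markovPassage stub_translationPassage

end Summit.CriticalPhenomena.SAWScalingLimit.Cruxes.SubseqLimitAxioms.Birth

end
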